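import Literature.Geometry.Kaehler.ComplexTorusNormEndomorphismComponentGroups
import Literature.Geometry.Kaehler.ComplexTorusComplementaryRestrictedPolarizations
import HarnessLib

/-!
# The image of `K(L)` under the norm-endomorphism: `u(K(L)) = K(M)` (Lange–Pauly 2009, Prop. 2.10) and
# the lattice identity `Λ(ι_B^*L) = p_V(Λ(L))`

Layer `Literature/Geometry/Kaehler`, namespace `Literature.Geometry.Kaehler.ComplexTorus`; lane
`lit-hodgefound`, Layer A2, row «A2-27(ao)» (self-proposed 2026-08-22, seat `lit-hodgefound-p10`, generation 8).
Sequel of `ComplexTorusComplementaryRestrictedPolarizations.lean` («A2-27(al)»: (2.14)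
`range_subKToTorus_eq_inf_sup`, `K(L_B) = B ∩ (B^⊥ + K(L))`), of `ComplexTorusNormEndomorphismComponentGroups.lean`
(«A2-27(am)»: the torsion `X[n] = torsionBy Φ n`, `B[n] = subtorus Φ V ⊓ torsionBy Φ n`, and
`(e_A - N_B)(π x) = π(e · (x - p_V x))`), and of `ComplexTorusNormEndomorphism(Principal).lean` /
`ComplexTorusSymmetricIdempotents.lean` (p10 gen 2: `N_B = normEndoInt Φ hη hV hVc`, `N_B(π x) = π(e(B) p_V x)`
(`mapMatrix_normEndoInt_proj`), `ε_B ⊗ ℝ = p_V` (`symmIdempotent_mulVec`), `E(p_V x, y) = E(x, p_V y)`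
(`twoForm_projection_comm`), and the PRINCIPAL case `ε_Y(Λ) = Λ(ι^*Θ)`
(`IsPrincipalPolarization.exists_symmIdempotent_mulVec_intVec_eq`) of the lattice identity of §1).

## Source, verbatim

H. Lange, C. Pauly, *Polarizations of Prym varieties for Weyl groups via abelianization*, J. Eur. Math. Soc. 11
(2009), §2 (held text `paper:arxiv-math_0702055`, p. 6 L124–L159).  Setting of §2: `(S, L)` a polarised abelian
variety, `u ∈ End(S)` symmetric with `u² = qu`, `A = Im u`, `P = Im(q - u)`; then `u = N_A` is the
norm-endomorphism of `A` and `u|_A = q`, so `q = e(A)` (LP09 (2.1)–(2.2), [BL] = Lange 2023 §2.4.3).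

> "**Proposition 2.10.** (a): If `L_A = M^q` for a polarization `M` on `A`, we have the following equality of
> subgroups of `A`, `K(M) = u(K(L))`, (b): If `L_P = N^q` for a polarization `N` on `P`, we have the following
> equality of subgroups of `P`, `K(N) = (q-u)(K(L))`.
> Note that `L_A = M^q` for a polarization `M` on `A` if and only if the polarization `L_A` is divisible by
> `q`, meaning that `A_q ⊂ K(L_A)`. In this case `K(M) = K(L_A)/A_q`.
> *Proof.* We take the quotient by `A ∩ P` of the inclusion `A_q ⊂ K(L_A)`. Since by Lemma 2.7,
> `A_q/A ∩ P ≅ G_P` and by Lemma 2.5, `K(L_A)/A ∩ P ≅ ker φ̂_A`, this gives an inclusion `G_P ⊂ ker φ̂_A`. Recall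
> that `G_P = ker u/P` and by Lemma 2.9, `ker φ̂_A = π_P(K(L))`. Therefore
> `K(M) = K(L_A)/A_q = ker φ̂_A / G_P = ((K(L) + P)/P)/(ker u/P) = (K(L) + P)/ker u = u(K(L))`."

## Presentation and what is proved

`X = S = E/Φ(ℤ^ι)` with a Riemann form `η` (ANY polarisation `L`, integer Gram matrix `G`), `K(L) = kerPhiH Φ G =
π(Λ(L))` (`Λ(L) = subDualLattice Φ η ⊤`), a complex sub-torus `B = π(V)` (LP09's `A`; `IsLatticeSubspace V`,
`IsComplexSubspace Φ V`), `Λ_B = subLattice V`, `Λ(ι_B^*L) = subDualLattice Φ η V = {v ∈ V ∣ E(v, Λ_B) ⊆ ℤ}`,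
`K(L_B) ⊂ B ⊂ X` the image `π(Λ(ι_B^*L)) = Set.range (subKToTorus Φ)` of `K(ι_B^*L)`, `p_V` the `E`-orthogonal
projection onto `V` (`V.projection V^⊥`), `u = N_B = ρ(normEndoInt Φ hη hV hVc)`, `q = e = e(B) = subExponent Φ η V`,
`B[n] = subtorus Φ V ⊓ torsionBy Φ n`.  The printed proof (a quotient chase through Lemmas 2.5, 2.7, 2.9) is
replaced by the lattice identity of §1, from which both (a) and (b) are one line:

* §1 **`image_projection_subDualLattice_top` : `p_V(Λ(L)) = Λ(ι_B^*L)`** for EVERY `L`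
  (`⊇`: `E(p_V x, m) = E(x, m)`; `⊆`: (2.14)), `exists_symmIdempotent_mulVec_eq` (`ε_B(Λ(L)) = Λ(ι_B^*L)`),
  **`range_subKToTorus_eq_image_proj_projection` : `K(L_B) = π(p_V Λ(L))`**, `image_nsmul_range_subKToTorus`
  (`n · K(L_B) = π(n p_V Λ(L))`);
* §2 **Proposition 2.10**: (a) **`image_normEndoInt_kerPhiH_eq` : `N_B(K(L)) = e(B) · K(L_B)`** and (b)
  **`image_sub_normEndoInt_kerPhiH_eq` : `(e(B) - N_B)(K(L)) = e(B) · K(L_P)`**, `P = B^⊥` — identities of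
  subsets of `X` valid for every pair (no divisibility needed in this form; LP09's `q - u = e(B) - N_B` is `N_P`
  exactly when `e(B) = e(P)`);
* §3 the divisibility sentences: **`image_proj_divDual_eq`** (`K(M) := π{v ∈ V ∣ E(v, Λ_B) ⊆ nℤ} = n · K(L_B)` —
  `K(M)` for the form `M = E|_{Λ_B}/n`, `L_B = M^n`), **`subtorus_inf_torsionBy_le_iff`** ("`L_A = M^q` iff
  `A_q ⊂ K(L_A)`": `B[n] ⊂ K(L_B) ⟺ n ∣ E(Λ_B, Λ_B)`), `range_subKToTorus_inter_torsionBy_eq` ("`K(M) = K(L_A)/A_q`":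
  under divisibility the kernel of `n·` on `K(L_B)` is `B[n]`), and the printed (a)
  **`image_proj_divDual_eq_image_normEndoInt_kerPhiH` : `K(M) = N_B(K(L))`** (`n = e(B)`).

Theorems only; no definition, no named fact.

## References

* [LangePauly2009] H. Lange, C. Pauly, *Polarizations of Prym varieties for Weyl groups via abelianization*,
  J. Eur. Math. Soc. 11 (2009) 315–349, doi:10.4171/jems/152, §2 Prop. 2.10 (and (2.1)–(2.4), Lemmas 2.5, 2.7, 2.9).
* [LangeRodriguez2022] H. Lange, R. E. Rodríguez, *Decomposition of Jacobians by Prym Varieties*, LNM 2310,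
  Springer (2022), §2.6.2 (2.14), p. 36 (the same §2 of Lange–Pauly, without Prop. 2.10).
* [Lange2023AbelianVarietiesComplex] H. Lange, *Abelian Varieties over the Complex Numbers*, Grundlehren Text
  Edition, Springer (2023), §2.4.3 (`N_Y`, `ε_Y`, `e(Y)`), §1.4.2 (1.14) (`K(L) = Λ(L)/Λ`), §1.1.2 Prop. 1.1.14 (`X_n`).
-/

noncomputable section

open Module Function Matrix

namespace Literature.Geometry.Kaehler

namespace ComplexTorus

variable {ι : Type*} [Fintype ι] [DecidableEq ι] {E : Type*} [NormedAddCommGroup E] [NormedSpace ℂ E]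
  (Φ : (ι → ℝ) ≃L[ℝ] E) {η : E [⋀^Fin 2]→L[ℝ] ℝ} {V : Submodule ℝ (ι → ℝ)}

/-! ### §0 Helpers -/

section Helpers

omit [Fintype ι] [DecidableEq ι] in
/-- `n • π(y) = π((n : ℝ) • y)`. [folklore] -/
private theorem nsmul_proj_real (n : ℕ) (y : ι → ℝ) : n • proj Φ y = proj Φ ((n : ℝ) • y) := by
  rw [← projHom_apply, ← map_nsmul, projHom_apply, Nat.cast_smul_eq_nsmul]

omit [Fintype ι] [DecidableEq ι] in
/-- Projections along equal complements agree. [folklore] -/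
private theorem projection_congr_right {p q q' : Submodule ℝ (ι → ℝ)} (hq : q = q') (h : IsCompl p q)
    (h' : IsCompl p q') (x : ι → ℝ) : p.projection q h x = p.projection q' h' x := by
  subst hq; rfl

omit [Fintype ι] [DecidableEq ι] in
/-- Every integer vector lies in `Λ(L) = Λ(ι_X^*L)` (the form is integral on `Λ`). [folklore] -/
private theorem intVec_mem_subDualLattice_top (hη : IsRiemannForm Φ η) (n : ι → ℤ) :
    intVec n ∈ subDualLattice Φ η ⊤ :=
  intVec_mem_subDualLattice Φ hη (by rw [subLattice_top]; exact Submodule.mem_top)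

end Helpers

/-! ### §1 The lattice: `Λ(ι_B^*L) = p_V(Λ(L))` for every polarisation -/

section Lattice

variable (hη : IsRiemannForm Φ η) (hV : IsLatticeSubspace V) (hVc : IsComplexSubspace Φ V)

omit [DecidableEq ι] in
/-- **`p_V(Λ(L)) ⊆ Λ(ι_B^*L)`**: the `E`-orthogonal projection of `x ∈ Λ(L)` (`E(x, Λ) ⊆ ℤ`) onto `V` lies in `V`
and pairs integrally with `Λ_B` (`E(p_V x, m) = E(x, p_V m) = E(x, m)`), cf. the tree's
`symmIdempotent_mulVec_intVec_mem_subDualLattice` (`ε_Y(Λ) ⊆ Λ(ι^*L)`).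
[cite: Lange2023AbelianVarietiesComplex, §2.4.3 (definition of `N_Y = ι ψ ι̂ φ_L`), p. 120] [cite: LangePauly2009, §2 Prop. 2.10 (proof), p. 6] -/
theorem projection_mem_subDualLattice {x : ι → ℝ} (hx : x ∈ subDualLattice Φ η ⊤) :
    V.projection (orthSubspace Φ η V) (isCompl_orthSubspace Φ hη hVc) x ∈ subDualLattice Φ η V := by
  refine (mem_subDualLattice_iff Φ).mpr ⟨Submodule.projection_apply_mem _ x, fun m hm ↦ ?_⟩
  obtain ⟨k, hk⟩ := ((mem_subDualLattice_iff Φ).mp hx).2 m (by rw [subLattice_top]; exact Submodule.mem_top)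
  exact ⟨k, by rw [twoForm_projection_comm Φ hη hVc, Submodule.projection_apply_of_mem_left _
    (mem_subLattice_iff.mp hm), hk]⟩

include hV in
/-- **`Λ(ι_B^*L) ⊆ p_V(Λ(L))`**: every `v ∈ V` with `E(v, Λ_B) ⊆ ℤ` is the projection of a vector of `Λ(L)` —
by (2.14) (`range_subKToTorus_eq_inf_sup`: `π(Λ(ι_B^*L)) = B ∩ (B^⊥ + K(L))`) `v = w + x + n` with `w ⊥ V`,
`x ∈ Λ(L)`, `n ∈ Λ`, so `v = p_V v = p_V(x + n)`.  (For a PRINCIPAL `L` this is the tree's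
`IsPrincipalPolarization.exists_symmIdempotent_mulVec_intVec_eq`, `ε_Y(Λ) = Λ(ι^*Θ)`.)
[cite: LangeRodriguez2022, §2.6.2 (2.14), p. 36] [cite: LangePauly2009, §2 (2.4) and Prop. 2.10, pp. 5–6] -/
theorem exists_projection_eq_of_mem_subDualLattice {v : ι → ℝ} (hv : v ∈ subDualLattice Φ η V) :
    ∃ x ∈ subDualLattice Φ η ⊤, V.projection (orthSubspace Φ η V) (isCompl_orthSubspace Φ hη hVc) x = v := by
  obtain ⟨G, hG⟩ := exists_intMatrix_latticeGram Φ η hη.2.1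
  have h214 := range_subKToTorus_eq_inf_sup Φ hη hG hV hVc (isCompl_orthSubspace Φ hη hVc).symm
    (fun _ hw _ hv ↦ by rw [twoForm_swap, twoForm_eq_zero_of_mem_orthSubspace Φ hv hw, neg_zero])
  have hπv : proj Φ v ∈ subtorus Φ V ⊓ (subtorus Φ (orthSubspace Φ η V) ⊔ kerPhiH Φ G) := by
    rw [← SetLike.mem_coe, ← h214, range_subKToTorus]
    exact ⟨v, hv, rfl⟩
  obtain ⟨z, hz, k, hk, hzk⟩ := AddSubgroup.mem_sup.mp (AddSubgroup.mem_inf.mp hπv).2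
  obtain ⟨w, hw, rfl⟩ := (mem_subtorus_iff Φ).mp hz
  rw [← proj_lift Φ k, ← proj_add] at hzk
  obtain ⟨n, hn⟩ := (proj_eq_proj_iff_exists_intVec Φ).mp hzk
  have hk' : lift Φ k ∈ subDualLattice Φ η ⊤ := (mem_subDualLattice_top_iff Φ hG _).mpr (by rwa [proj_lift])
  refine ⟨lift Φ k + intVec n, Submodule.add_mem _ hk' (intVec_mem_subDualLattice_top Φ hη n), ?_⟩
  have hvV : v ∈ V := ((mem_subDualLattice_iff Φ).mp hv).1
  have hc := isCompl_orthSubspace Φ hη hVc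
  calc V.projection (orthSubspace Φ η V) hc (lift Φ k + intVec n)
      = V.projection (orthSubspace Φ η V) hc (w + (lift Φ k + intVec n)) -
          V.projection (orthSubspace Φ η V) hc w := by
        rw [map_add (V.projection (orthSubspace Φ η V) hc) w, add_sub_cancel_left]
    _ = v := by
      rw [← add_assoc, ← hn, Submodule.projection_apply_of_mem_right _ hw, sub_zero,
        Submodule.projection_apply_of_mem_left _ hvV]

include hV in
/-- **`Λ(ι_B^*L) = p_V(Λ(L))`** for EVERY polarisation `L` and every complex sub-torus `B = π(V)` — the
lattice identity behind Lange–Pauly's Prop. 2.10 (`u = N_B = e(B) p_V` maps `Λ(L)` onto `e(B) Λ(ι_B^*L)`).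
[cite: LangePauly2009, §2 Prop. 2.10, p. 6] [cite: LangeRodriguez2022, §2.6.2 (2.14), p. 36] -/
theorem image_projection_subDualLattice_top :
    V.projection (orthSubspace Φ η V) (isCompl_orthSubspace Φ hη hVc) '' (subDualLattice Φ η ⊤ : Set (ι → ℝ)) =
      subDualLattice Φ η V := by
  ext v
  constructor
  · rintro ⟨x, hx, rfl⟩
    exact projection_mem_subDualLattice Φ hη hVc hx
  · intro hv
    obtain ⟨x, hx, hxv⟩ := exists_projection_eq_of_mem_subDualLattice Φ hη hV hVc hv
    exact ⟨x, hx, hxv⟩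

/-- **`ε_B(Λ(L)) = Λ(ι_B^*L)`** with the tree's rational idempotent `ε_B = symmIdempotent` (`ε_B ⊗ ℝ = p_V`).
[cite: Lange2023AbelianVarietiesComplex, §2.4.3, pp. 120–121] [cite: LangePauly2009, §2 Prop. 2.10, p. 6] -/
theorem exists_symmIdempotent_mulVec_eq {v : ι → ℝ} (hv : v ∈ subDualLattice Φ η V) :
    ∃ x ∈ subDualLattice Φ η ⊤, (symmIdempotent Φ hη hV hVc).map (Rat.cast : ℚ → ℝ) *ᵥ x = v := by
  obtain ⟨x, hx, hxv⟩ := exists_projection_eq_of_mem_subDualLattice Φ hη hV hVc hv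
  exact ⟨x, hx, by rw [symmIdempotent_mulVec, hxv]⟩

include hV in
/-- **`K(L_B) = π(p_V Λ(L))`**: the image of `K(ι_B^*L) = Λ(ι_B^*L)/Λ_B` in `X` (the range of the tree's
`subKToTorus`) is `{π(p_V x) ∣ x ∈ Λ(L)}`. [cite: LangePauly2009, §2 Prop. 2.10, p. 6] [cite: LangeRodriguez2022, §2.6.2 (2.14), p. 36] -/
theorem range_subKToTorus_eq_image_proj_projection :
    Set.range (subKToTorus Φ (η := η) (V := V)) =
      (fun x ↦ proj Φ (V.projection (orthSubspace Φ η V) (isCompl_orthSubspace Φ hη hVc) x)) ''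
        (subDualLattice Φ η ⊤ : Set (ι → ℝ)) := by
  rw [range_subKToTorus, ← image_projection_subDualLattice_top Φ hη hV hVc, Set.image_image]

include hV in
/-- **`n · K(L_B) = π(n p_V Λ(L))`** for every `n`. [cite: LangePauly2009, §2 Prop. 2.10, p. 6] -/
theorem image_nsmul_range_subKToTorus (n : ℕ) :
    (fun t ↦ n • t) '' Set.range (subKToTorus Φ (η := η) (V := V)) =
      (fun x ↦ proj Φ ((n : ℝ) • V.projection (orthSubspace Φ η V) (isCompl_orthSubspace Φ hη hVc) x)) ''
        (subDualLattice Φ η ⊤ : Set (ι → ℝ)) := by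
  rw [range_subKToTorus_eq_image_proj_projection Φ hη hV hVc, Set.image_image]
  simp_rw [nsmul_proj_real]

end Lattice

/-! ### §2 Proposition 2.10 (Lange–Pauly): `u(K(L)) = e(B) · K(L_B)` and `(q - u)(K(L)) = e(B) · K(L_P)` -/

section Prop210

variable (hη : IsRiemannForm Φ η) (hV : IsLatticeSubspace V) (hVc : IsComplexSubspace Φ V)

/-- **Proposition 2.10 (a) (Lange–Pauly 2009): `u(K(L)) = K(M)`, in the form `N_B(K(L)) = e(B) · K(L_B)`**
valid for EVERY pair: the norm-endomorphism `u = N_B = ρ(normEndoInt)` (`N_B(π x) = π(e(B) p_V x)`) maps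
`K(L) = π(Λ(L))` onto `π(e(B) p_V Λ(L)) = e(B) · π(Λ(ι_B^*L)) = e(B) · K(L_B)`; when `L_B = M^{e(B)}` the
right-hand side is `K(M)` (`image_proj_divDual_eq`). [cite: LangePauly2009, §2 Prop. 2.10 (a), p. 6] -/
theorem image_normEndoInt_kerPhiH_eq {G : Matrix ι ι ℤ} (hG : G.map (Int.cast : ℤ → ℝ) = latticeGram Φ η) :
    mapMatrix Φ Φ (normEndoInt Φ hη hV hVc) '' (kerPhiH Φ G : Set (ComplexTorus Φ)) =
      (fun t ↦ subExponent Φ η V • t) '' Set.range (subKToTorus Φ (η := η) (V := V)) := by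
  rw [image_nsmul_range_subKToTorus Φ hη hV hVc]
  ext t
  constructor
  · rintro ⟨k, hk, rfl⟩
    refine ⟨lift Φ k, (mem_subDualLattice_top_iff Φ hG _).mpr (by rwa [proj_lift]), ?_⟩
    conv_rhs => rw [← proj_lift Φ k]
    rw [mapMatrix_normEndoInt_proj]
  · rintro ⟨x, hx, rfl⟩
    exact ⟨proj Φ x, (mem_subDualLattice_top_iff Φ hG x).mp hx, by rw [mapMatrix_normEndoInt_proj]⟩

/-- **Proposition 2.10 (b) (Lange–Pauly 2009): `(q - u)(K(L)) = K(N)`, in the form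
`(e(B)_A - N_B)(K(L)) = e(B) · K(L_P)`** for `P = B^⊥` (`(e_A - N_B)(π x) = π(e(B) p_{V^⊥} x)`; the endomorphism
`q - u = e(B) - N_B` is `N_P` exactly when `e(B) = e(P)`). [cite: LangePauly2009, §2 Prop. 2.10 (b), p. 6] -/
theorem image_sub_normEndoInt_kerPhiH_eq {G : Matrix ι ι ℤ} (hG : G.map (Int.cast : ℤ → ℝ) = latticeGram Φ η) :
    mapMatrix Φ Φ ((subExponent Φ η V : ℤ) • (1 : Matrix ι ι ℤ) - normEndoInt Φ hη hV hVc) ''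
        (kerPhiH Φ G : Set (ComplexTorus Φ)) =
      (fun t ↦ subExponent Φ η V • t) ''
        Set.range (subKToTorus Φ (η := η) (V := orthSubspace Φ η V)) := by
  have hW := isLatticeSubspace_orthSubspace Φ hη hV hVc
  have hWc := isComplexSubspace_orthSubspace Φ hη.1 hVc
  rw [image_nsmul_range_subKToTorus Φ hη hW hWc]
  -- `x - p_V x = p_{V^⊥} x`, the projection onto `V^⊥` along `(V^⊥)^⊥ = V`
  have hpr : ∀ x : ι → ℝ, x - V.projection (orthSubspace Φ η V) (isCompl_orthSubspace Φ hη hVc) x =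
      (orthSubspace Φ η V).projection (orthSubspace Φ η (orthSubspace Φ η V)) (isCompl_orthSubspace Φ hη hWc) x :=
    fun x ↦ by
    rw [← Submodule.projection_eq_self_sub_projection,
      projection_congr_right (orthSubspace_orthSubspace Φ hη hVc).symm]
  ext t
  constructor
  · rintro ⟨k, hk, rfl⟩
    refine ⟨lift Φ k, (mem_subDualLattice_top_iff Φ hG _).mpr (by rwa [proj_lift]), ?_⟩
    conv_rhs => rw [← proj_lift Φ k]
    rw [← mapMatrixHom_apply, mapMatrixHom_sub_normEndoInt_proj, hpr]
  · rintro ⟨x, hx, rfl⟩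
    refine ⟨proj Φ x, (mem_subDualLattice_top_iff Φ hG x).mp hx, ?_⟩
    rw [← mapMatrixHom_apply, mapMatrixHom_sub_normEndoInt_proj, hpr]

end Prop210

/-! ### §3 Divisibility `L_B = M^n`: `B[n] ⊂ K(L_B) ⟺ n ∣ E(Λ_B, Λ_B)`, and `K(M) = n · K(L_B) = K(L_B)/B[n]` -/

section Divisible

variable (hη : IsRiemannForm Φ η) (hV : IsLatticeSubspace V) (hVc : IsComplexSubspace Φ V)

omit [Fintype ι] [DecidableEq ι] in
/-- **`K(M) = n · K(L_B)` for the form `M = E|_{Λ_B}/n`**: `π{v ∈ V ∣ E(v, Λ_B) ⊆ nℤ} = n · π(Λ(ι_B^*L))`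
(`E(v, Λ_B) ⊆ nℤ ⟺ v/n ∈ Λ(ι_B^*L)`).  When `n ∣ E(Λ_B, Λ_B)`, `M` is an integral form on `Λ_B` with
`L_B = M^n` and the left-hand side is its `K(M) = Λ(M)/Λ_B` read in `X`. [cite: LangePauly2009, §2 Prop. 2.10 ("`K(M) = K(L_A)/A_q`"), p. 6] -/
theorem image_proj_divDual_eq {n : ℕ} (hn : 0 < n) :
    proj Φ '' {v : ι → ℝ | v ∈ V ∧ ∀ m ∈ subLattice V, ∃ k : ℤ, η ![Φ v, Φ (intVec m)] = (n : ℝ) * k} =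
      (fun t ↦ n • t) '' Set.range (subKToTorus Φ (η := η) (V := V)) := by
  have hn0 : (n : ℝ) ≠ 0 := by exact_mod_cast hn.ne'
  rw [range_subKToTorus]
  ext t
  constructor
  · rintro ⟨v, ⟨hvV, hv⟩, rfl⟩
    refine ⟨proj Φ ((n : ℝ)⁻¹ • v), ⟨(n : ℝ)⁻¹ • v, (mem_subDualLattice_iff Φ).mpr ⟨V.smul_mem _ hvV, fun m hm ↦ ?_⟩,
      rfl⟩, ?_⟩
    · obtain ⟨k, hk⟩ := hv m hm
      exact ⟨k, by rw [map_smul, twoForm_smul_left, hk, inv_mul_cancel_left₀ hn0]⟩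
    · change n • proj Φ ((n : ℝ)⁻¹ • v) = proj Φ v
      rw [nsmul_proj_real, smul_inv_smul₀ hn0]
  · rintro ⟨_, ⟨u, hu, rfl⟩, rfl⟩
    obtain ⟨huV, hu'⟩ := (mem_subDualLattice_iff Φ).mp hu
    refine ⟨(n : ℝ) • u, ⟨V.smul_mem _ huV, fun m hm ↦ ?_⟩, ?_⟩
    · obtain ⟨k, hk⟩ := hu' m hm
      exact ⟨k, by rw [map_smul, twoForm_smul_left, hk]⟩
    · change proj Φ ((n : ℝ) • u) = n • proj Φ u
      rw [nsmul_proj_real]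

include hη in
/-- **"`L_A = M^q` for a polarization `M` on `A` if and only if `A_q ⊂ K(L_A)`"**, on the lattice: the
`n`-torsion `B[n] = π(n⁻¹Λ_B)` of the sub-torus lies in `K(L_B) = π(Λ(ι_B^*L))` iff `n ∣ E(m, m')` for all
`m, m' ∈ Λ_B` (iff `E|_{Λ_B}/n` is an integral form `M`, `L_B = M^n`). [cite: LangePauly2009, §2 Prop. 2.10 (the Note), p. 6] -/
theorem subtorus_inf_torsionBy_le_iff {n : ℕ} (hn : 0 < n) :
    (↑(subtorus Φ V ⊓ torsionBy Φ n) : Set (ComplexTorus Φ)) ⊆ Set.range (subKToTorus Φ (η := η) (V := V)) ↔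
      ∀ m ∈ subLattice V, ∀ m' ∈ subLattice V, ∃ k : ℤ, η ![Φ (intVec m), Φ (intVec m')] = (n : ℝ) * k := by
  have hn0 : (n : ℝ) ≠ 0 := by exact_mod_cast hn.ne'
  rw [range_subKToTorus]
  constructor
  · intro h m hm m' hm'
    -- `π(m/n) ∈ B[n] ⊆ π(Λ(ι_B^*L))`
    have hmem : proj Φ ((n : ℝ)⁻¹ • intVec m) ∈ (↑(subtorus Φ V ⊓ torsionBy Φ n) : Set (ComplexTorus Φ)) := by
      rw [SetLike.mem_coe]
      refine AddSubgroup.mem_inf.mpr ⟨(mem_subtorus_iff Φ).mpr ⟨_, V.smul_mem _ (mem_subLattice_iff.mp hm), rfl⟩,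
        (proj_mem_torsionBy_iff Φ).mpr ⟨m, ?_⟩⟩
      rw [Int.cast_natCast, smul_inv_smul₀ hn0]
    obtain ⟨u, hu, hu'⟩ := h hmem
    obtain ⟨n', hn'⟩ := (proj_eq_proj_iff_exists_intVec Φ).mp hu'
    -- `m/n = u + n'` with `n' ∈ Λ ∩ V = Λ_B ⊆ Λ(ι_B^*L)`, so `m/n ∈ Λ(ι_B^*L)`
    obtain ⟨huV, -⟩ := (mem_subDualLattice_iff Φ).mp hu
    have hn'V : n' ∈ subLattice V := by
      rw [mem_subLattice_iff, show intVec n' = (n : ℝ)⁻¹ • intVec m - u by rw [hn', add_sub_cancel_left]]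
      exact V.sub_mem (V.smul_mem _ (mem_subLattice_iff.mp hm)) huV
    have hdiv : (n : ℝ)⁻¹ • intVec m ∈ subDualLattice Φ η V := by
      rw [hn']
      exact Submodule.add_mem _ hu (intVec_mem_subDualLattice Φ hη hn'V)
    obtain ⟨k, hk⟩ := ((mem_subDualLattice_iff Φ).mp hdiv).2 m' hm'
    refine ⟨k, ?_⟩
    rw [map_smul, twoForm_smul_left] at hk
    rw [← hk, mul_inv_cancel_left₀ hn0]
  · rintro h _ ⟨htB, htn⟩
    obtain ⟨v, hv, rfl⟩ := (mem_subtorus_iff Φ).mp htB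
    obtain ⟨m, hm⟩ := (proj_mem_torsionBy_iff Φ).mp htn
    rw [Int.cast_natCast] at hm
    -- `n v = m ∈ Λ ∩ V`
    have hmV : m ∈ subLattice V := by
      rw [mem_subLattice_iff, ← hm]; exact V.smul_mem _ hv
    refine ⟨v, (mem_subDualLattice_iff Φ).mpr ⟨hv, fun m' hm' ↦ ?_⟩, rfl⟩
    obtain ⟨k, hk⟩ := h m hmV m' hm'
    refine ⟨k, ?_⟩
    have hv' : v = (n : ℝ)⁻¹ • intVec m := by rw [← hm, inv_smul_smul₀ hn0]
    rw [hv', map_smul, twoForm_smul_left, hk, inv_mul_cancel_left₀ hn0]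

/-- **`K(M) = K(L_A)/A_q`, the kernel**: when `B[n] ⊂ K(L_B)` (divisibility), the kernel of multiplication by
`n` on `K(L_B)` — `K(L_B) ∩ X[n]` — is exactly `B[n]` (so `t ↦ n · t` induces `K(L_B)/B[n] ≃ n · K(L_B) = K(M)`,
`image_proj_divDual_eq`). [cite: LangePauly2009, §2 Prop. 2.10 ("In this case `K(M) = K(L_A)/A_q`"), p. 6] -/
theorem range_subKToTorus_inter_torsionBy_eq {n : ℕ}
    (hdiv : (↑(subtorus Φ V ⊓ torsionBy Φ n) : Set (ComplexTorus Φ)) ⊆ Set.range (subKToTorus Φ (η := η) (V := V))) :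
    Set.range (subKToTorus Φ (η := η) (V := V)) ∩ ↑(torsionBy Φ (n : ℤ)) = ↑(subtorus Φ V ⊓ torsionBy Φ n) := by
  refine Set.Subset.antisymm ?_ fun t ht ↦ ⟨hdiv ht, (AddSubgroup.mem_inf.mp ht).2⟩
  rintro t ⟨htK, htn⟩
  rw [range_subKToTorus] at htK
  obtain ⟨v, hv, rfl⟩ := htK
  exact AddSubgroup.mem_inf.mpr ⟨(mem_subtorus_iff Φ).mpr ⟨v, ((mem_subDualLattice_iff Φ).mp hv).1, rfl⟩, htn⟩

/-- **Proposition 2.10 (a), as printed: `K(M) = u(K(L))`** — if `L_B = M^e`, `e = e(B)` (`B[e] ⊂ K(L_B)`, i.e.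
`e ∣ E(Λ_B, Λ_B)`), then `K(M) = π{v ∈ V ∣ E(v, Λ_B) ⊆ eℤ}` equals `N_B(K(L))` as subsets of `B ⊂ X`.  (The
identity holds for every pair; the divisibility only makes `M` a polarisation of `B`.)
[cite: LangePauly2009, §2 Prop. 2.10 (a), p. 6] -/
theorem image_proj_divDual_eq_image_normEndoInt_kerPhiH {G : Matrix ι ι ℤ}
    (hG : G.map (Int.cast : ℤ → ℝ) = latticeGram Φ η) :
    proj Φ '' {v : ι → ℝ | v ∈ V ∧ ∀ m ∈ subLattice V, ∃ k : ℤ,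
        η ![Φ v, Φ (intVec m)] = (subExponent Φ η V : ℝ) * k} =
      mapMatrix Φ Φ (normEndoInt Φ hη hV hVc) '' (kerPhiH Φ G : Set (ComplexTorus Φ)) := by
  rw [image_proj_divDual_eq Φ (subExponent_pos Φ hη hV hVc), image_normEndoInt_kerPhiH_eq Φ hη hV hVc hG]

end Divisible

end ComplexTorus

end Literature.Geometry.Kaehler

end
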